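import Summits.CriticalPhenomena.PercolationContinuityZ3.Theorems.Transplant.KNLevelsTargetPropertyUniformP
import HarnessLib

/-!
# F7 (generic), part 5 — the SOURCE-ADDITIVE target property and its ADDITIVE chains (NEG-SCOPE §B.19 (Q′); design owner p3-g11)

builds on p205010 (kernel theorem, internal audit signed; external expert review pending) — nothing in this file uses p205010; no claim
about the open node `SamePDropOfSkeletonNeg₁`.
Lane `prim-bschramm`, seat `prim-bschramm-p3` (gen 11; N1 design owner); helper file (`--supports stmt-CriticalPhenomena-4575`).

WHY.  The parameter-uniform target property of record `KNLevels.TargetPropertyUP` (part 4) BUNDLES one accuracy `δ` for the SOURCE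
(`1 − δ < P_W(o ↔ B⟨0⟩)`) and for the KITS, and its chain lemma `TargetPropertyUP.chain_edge` NESTS it (`δ(n+1, ε) = min(δ_chain(n,
δ_step ε), δ_step ε, ε)`): the source of a corridor of `n` rounds must be known at confidence `δ_step^{∘n}(ε)`.  In the N1 closure of record
the corridor's source is KN's (32) at the scheme threshold `δc`, and `δ₂`, `K₀` are functions of `δc` — so the corridor length must be fixed
BEFORE `K₀` (`Skel.nmaxN`), which is the invariant [I1] behind the B.18 wall (NEG-SCOPE §B.18/B.19).  This file records the SOURCE-ADDITIVE
form of the one-step property — conclusion `P_W(o ↔ T) ≥ P_W(o ↔ B⟨0⟩) − C·δ` with NO source hypothesis — as a predicate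
**`AdditiveTargetPropertyUP V Δ`** (to be discharged from the tree theorem `AdditiveGluing_proof` by the Step-V twin, NEG-SCOPE §B.19
(Q′-1)), and proves what follows from it by bookkeeping alone:
* `AdditiveTargetPropertyUP.targetPropertyUP` — the additive form implies the bundled one (`δ := ε / (C + 2)`), so nothing of record is lost;
* `AdditiveTargetPropertyUP.apply_step` — one `TStep` with kits at `δ`: `P(o ↔ T) ≥ P(o ↔ X 0) − C·δ`;
* **`AdditiveTargetPropertyUP.chain_edge_additive`** — linked chains of `n + 1` steps with true targets `T'_i ⊆ T_i`, kits at `δ`, excess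
  `≤ η`: `P(o ↔ T'_n) ≥ P(o ↔ X_0(0)) − (n + 1)·(C·δ + η)` — the source enters ONCE, additively, whatever `n` is (no gluing is needed for the
  composition: `{o ↔ T'_i} ⊆ reachB(i+1)`);
* `AdditiveTargetPropertyUP.chain_edge_from_source` — the `1 − ε` shape a closure consumes: source at `1 − δs`, conclusion at
  `1 − (δs + (n+1)(Cδ + η))`.
[cite: KozmaNitzan2024, §4 Lemma 10 (p. 17), Lemma 11 (p. 22), Lemma 12 (pp. 23–25)] [this work]
-/

noncomputable section

open MeasureTheory ProbabilityTheory
open scoped ENNReal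

namespace Summit.CriticalPhenomena.PercolationContinuityZ3.Theorems

namespace Transplant

namespace KNLevels

open Literature.Probability.Percolation Literature.Probability.LatticeModels SimpleGraph

/-! ## §1 The source-additive target property -/

/-- **The SOURCE-ADDITIVE target property, uniform in the parameter and the graph**: there is an absolute `C ≥ 0` such that for every kit
accuracy `δ ∈ (0, 1]`, every `p < 1`, every graph on `V` with degrees `≤ Δ`, every level datum with the hypotheses of Kozma–Nitzan's Lemma 10
(window inside the depth, nonempty target inside `D`, enough levels for Step II, a Step-III/IV kit at accuracy `δ` at every level of the
window) — and NO hypothesis on the source — `P_W(o ↔ T) ≥ P_W(o ↔ B⟨0⟩) − C·δ`.  (Same binder list as `TargetPropertyUP`; the source bound is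
moved into the conclusion.) [cite: KozmaNitzan2024, §4 Lemma 10 (pp. 17–22)] [this work] -/
def AdditiveTargetPropertyUP (V : Type) [DecidableEq V] (Δ : ℕ) : Prop :=
  ∃ C : ℝ, 0 ≤ C ∧ ∀ ⦃δ : ℝ⦄, 0 < δ → δ ≤ 1 → ∀ (p : unitInterval), (p : ℝ) < 1 →
    ∀ (G : SimpleGraph V) [G.LocallyFinite], (∀ x, G.degree x ≤ Δ) →
    ∀ (L : LData G) (W : Sym2 V → unitInterval) (D T : Finset V) (R N j₀ j₁ : ℕ),
    LHyp L W p D R → j₁ ≤ R → T ⊆ D → T.Nonempty →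
    1 / (1 - (p : ℝ)) ^ (Δ * N) ≤ δ * ((Finset.Icc j₀ j₁).card : ℝ) →
    (∀ j ∈ Finset.Icc j₀ j₁, ∃ (σ : SData V) (S : Finset V), SHyp L j σ ∧ σ.N ≤ N ∧
      (1 - (p : ℝ) ^ σ.sB) ^ σ.k ≤ δ ∧ S ⊆ L.X j ∧ S ⊆ D ∧
      (∀ x ∈ σ.K, ∀ e ∈ σ.seed x, e ∉ wireSet (↑S : Set V)) ∧ (∀ x ∈ σ.K, σ.face x ⊆ S) ∧
      (∀ x ∈ σ.K, 1 - 3 * δ ≤ (prodBernoulli W).real {ω | ∃ u ∈ σ.face x,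
        1 - δ < (prodBernoulli (pinW W (wireSet (↑S : Set V)) ω)).real (⋃ t ∈ T, openConnIn (↑D : Set V) u t)})) →
      (prodBernoulli W).real L.reachB - C * δ ≤ (prodBernoulli W).real (⋃ t ∈ T, openConn L.o t)

variable {V : Type} [DecidableEq V]

namespace AdditiveTargetPropertyUP

/-- **The additive form implies the bundled one** (`TargetPropertyUP`), with the explicit accuracy `δ := ε / (C + 2)`: if moreover
`P(o ↔ B⟨0⟩) > 1 − δ` then `P(o ↔ T) > 1 − δ − Cδ ≥ 1 − ε`. [this work] -/
theorem targetPropertyUP {Δ : ℕ} (hA : AdditiveTargetPropertyUP V Δ) : TargetPropertyUP V Δ := by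
  obtain ⟨C, hC0, h⟩ := hA
  intro ε hε
  have hC2 : 0 < C + 2 := by linarith
  refine ⟨min 1 (ε / (C + 2)), lt_min one_pos (div_pos hε hC2), min_le_left _ _, ?_⟩
  intro p hp1 G _ hΔ L W D T R N j₀ j₁ hL hj hTD hTne hJ hkits hreach
  set δ : ℝ := min 1 (ε / (C + 2)) with hδ
  have hδpos : 0 < δ := lt_min one_pos (div_pos hε hC2)
  have hδ1 : δ ≤ 1 := min_le_left _ _
  have hδε : δ ≤ ε / (C + 2) := min_le_right _ _
  have hmain := h hδpos hδ1 p hp1 G hΔ L W D T R N j₀ j₁ hL hj hTD hTne hJ hkits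
  have hCδ : (C + 1) * δ ≤ ε := by
    have : (C + 1) * δ ≤ (C + 1) * (ε / (C + 2)) := mul_le_mul_of_nonneg_left hδε (by linarith)
    have h2 : (C + 1) * (ε / (C + 2)) ≤ ε := by
      rw [mul_div_assoc']
      rw [div_le_iff₀ hC2]
      nlinarith
    linarith
  nlinarith

/-- **One application to a `TStep` with kits**, source-additive: `P(o ↔ T) ≥ P(o ↔ X 0) − C·δ`. [cite: KozmaNitzan2024, §4 Lemma 10 (p. 17)]
[this work] -/
theorem apply_step {Δ : ℕ} (hA : AdditiveTargetPropertyUP V Δ) :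
    ∃ C : ℝ, 0 ≤ C ∧ ∀ ⦃δ : ℝ⦄, 0 < δ → δ ≤ 1 → ∀ (p : unitInterval), (p : ℝ) < 1 →
      ∀ (G : SimpleGraph V) [G.LocallyFinite], (∀ x, G.degree x ≤ Δ) →
      ∀ (W : Sym2 V → unitInterval) (s : TStep G), s.KitsAt W p Δ δ →
        (prodBernoulli W).real s.L.reachB - C * δ ≤ (prodBernoulli W).real (⋃ t ∈ s.T, openConn s.L.o t) := by
  obtain ⟨C, hC0, h⟩ := hA
  refine ⟨C, hC0, fun δ hδ hδ1 p hp1 G _ hΔ W s hk => ?_⟩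
  obtain ⟨hL, hj, hTD, hTne, hJ, hkits⟩ := hk
  exact h hδ hδ1 p hp1 G hΔ s.L W s.D s.T s.R s.N s.j₀ s.j₁ hL hj hTD hTne hJ hkits

/-- **ADDITIVE CHAINS with enlarged targets**: for a chain `s₀, …, s_n` with a common source, true targets `T'_i ⊆ T_i` linked by
`T'_i ⊆ X_{i+1}(0)`, kits at accuracy `δ ∈ (0, 1]` on every step and excess `P_W(o ↔ T_i \ T'_i) ≤ η`, the conclusion loses the source ONCE and
`C·δ + η` per step: `P_W(o ↔ X_0(0)) − (n + 1)·(C·δ + η) ≤ P_W(o ↔ T'_n)`.  No gluing enters the composition (`{o ↔ T'_i} ⊆ reachB(i+1)` by the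
link), and `δ` is NOT compared with the source. [cite: KozmaNitzan2024, §4 Lemma 11 (p. 22), Lemma 12 (pp. 23–25)] [this work] -/
theorem chain_edge_additive {Δ : ℕ} (hA : AdditiveTargetPropertyUP V Δ) :
    ∃ C : ℝ, 0 ≤ C ∧ ∀ (n : ℕ) ⦃δ : ℝ⦄, 0 < δ → δ ≤ 1 → ∀ (p : unitInterval), (p : ℝ) < 1 →
      ∀ (G : SimpleGraph V) [G.LocallyFinite], (∀ x, G.degree x ≤ Δ) →
      ∀ (W : Sym2 V → unitInterval) (s : Fin (n + 1) → TStep G) (T' : Fin (n + 1) → Finset V) (η : ℝ),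
      (∀ i : Fin (n + 1), (s i).L.o = (s 0).L.o) →
      (∀ i : Fin n, T' (Fin.castSucc i) ⊆ (s i.succ).L.X 0) →
      (∀ i : Fin (n + 1), T' i ⊆ (s i).T) →
      (∀ i : Fin (n + 1), (s i).KitsAt W p Δ δ) →
      (∀ i : Fin (n + 1), (prodBernoulli W).real (⋃ t ∈ (s i).T \ T' i, openConn (s 0).L.o t) ≤ η) →
        (prodBernoulli W).real (s 0).L.reachB - (n + 1 : ℕ) * (C * δ + η) ≤
          (prodBernoulli W).real (⋃ t ∈ T' (Fin.last n), openConn (s 0).L.o t) := by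
  obtain ⟨C, hC0, hstep⟩ := hA.apply_step
  refine ⟨C, hC0, fun n => ?_⟩
  induction n with
  | zero =>
    intro δ hδ hδ1 p hp1 G _ hΔ W s T' η _ _ hsub hk hexc
    have h1 := hstep hδ hδ1 p hp1 G hΔ W (s 0) (hk 0)
    have h2 := real_biUnion_openConn_le_add_sdiff (prodBernoulli W) (s 0).L.o (hsub 0)
    have h3 := hexc 0
    show (prodBernoulli W).real (s 0).L.reachB - (0 + 1 : ℕ) * (C * δ + η) ≤ (prodBernoulli W).real (⋃ t ∈ T' 0, openConn (s 0).L.o t)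
    push_cast
    linarith
  | succ n ih =>
    intro δ hδ hδ1 p hp1 G _ hΔ W s T' η ho hlink hsub hk hexc
    -- the truncated chain
    set s' : Fin (n + 1) → TStep G := fun i => s (Fin.castSucc i) with hs'
    set T'' : Fin (n + 1) → Finset V := fun i => T' (Fin.castSucc i) with hT''
    have ho' : ∀ i : Fin (n + 1), (s' i).L.o = (s' 0).L.o := fun i => by
      simp only [hs']; rw [ho (Fin.castSucc i)]; exact (ho (Fin.castSucc 0)).symm
    have h0 : (s' 0).L.o = (s 0).L.o := rfl
    have hlink' : ∀ i : Fin n, T'' (Fin.castSucc i) ⊆ (s' i.succ).L.X 0 := fun i => by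
      simp only [hs', hT'']
      have := hlink (Fin.castSucc i)
      have e : (Fin.castSucc i).succ = Fin.castSucc i.succ := Fin.ext (by simp)
      rwa [e] at this
    have hsub' : ∀ i : Fin (n + 1), T'' i ⊆ (s' i).T := fun i => hsub (Fin.castSucc i)
    have hk' : ∀ i : Fin (n + 1), (s' i).KitsAt W p Δ δ := fun i => hk (Fin.castSucc i)
    have hexc' : ∀ i : Fin (n + 1), (prodBernoulli W).real (⋃ t ∈ (s' i).T \ T'' i, openConn (s' 0).L.o t) ≤ η := fun i => by
      rw [h0]; exact hexc (Fin.castSucc i)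
    have hmid := ih hδ hδ1 p hp1 G hΔ W s' T'' η ho' hlink' hsub' hk' hexc'
    have hs0 : (s' 0) = s 0 := rfl
    rw [hs0] at hmid
    -- `T'_n ⊆ X_{n+1}(0)`: the last step's level zero is reached at least as often as `T'_n`
    have hlastlink : T'' (Fin.last n) ⊆ (s (Fin.last (n + 1))).L.X 0 := by
      have := hlink (Fin.last n)
      simp only [hT'']
      rwa [Fin.succ_last] at this
    have holast : (s (Fin.last (n + 1))).L.o = (s 0).L.o := ho _
    have hsubB : (⋃ t ∈ T'' (Fin.last n), openConn (s 0).L.o t) ⊆ (s (Fin.last (n + 1))).L.reachB := by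
      intro ω hω
      simp only [Set.mem_iUnion, exists_prop] at hω
      obtain ⟨t, ht, hωt⟩ := hω
      unfold LData.reachB
      rw [holast]
      exact Set.mem_biUnion (Finset.mem_coe.2 (hlastlink ht)) hωt
    have hreachLast : (prodBernoulli W).real (⋃ t ∈ T'' (Fin.last n), openConn (s 0).L.o t) ≤
        (prodBernoulli W).real (s (Fin.last (n + 1))).L.reachB := measureReal_mono hsubB (measure_ne_top _ _)
    have h1 := hstep hδ hδ1 p hp1 G hΔ W (s (Fin.last (n + 1))) (hk _)
    rw [holast] at h1
    have h2 := real_biUnion_openConn_le_add_sdiff (prodBernoulli W) (s 0).L.o (hsub (Fin.last (n + 1)))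
    have h3 := hexc (Fin.last (n + 1))
    push_cast at hmid ⊢
    nlinarith

/-- **The shape a closure consumes**: source at confidence `1 − δs`, kits at `δ`, excess `≤ η` ⟹ conclusion at
`1 − (δs + (n+1)(C·δ + η))`.  With `δs := δc` (KN's (32)) fixed FIRST and `δ, η` chosen AFTER the length `n`, this is the corridor estimate of
NEG-SCOPE §B.19 (Q′-3): the scheme threshold no longer bounds the corridor length. [this work] -/
theorem chain_edge_from_source {Δ : ℕ} (hA : AdditiveTargetPropertyUP V Δ) :
    ∃ C : ℝ, 0 ≤ C ∧ ∀ (n : ℕ) ⦃δ : ℝ⦄, 0 < δ → δ ≤ 1 → ∀ (δs : ℝ) (p : unitInterval), (p : ℝ) < 1 →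
      ∀ (G : SimpleGraph V) [G.LocallyFinite], (∀ x, G.degree x ≤ Δ) →
      ∀ (W : Sym2 V → unitInterval) (s : Fin (n + 1) → TStep G) (T' : Fin (n + 1) → Finset V) (η : ℝ),
      (∀ i : Fin (n + 1), (s i).L.o = (s 0).L.o) →
      (∀ i : Fin n, T' (Fin.castSucc i) ⊆ (s i.succ).L.X 0) →
      (∀ i : Fin (n + 1), T' i ⊆ (s i).T) →
      (∀ i : Fin (n + 1), (s i).KitsAt W p Δ δ) →
      (∀ i : Fin (n + 1), (prodBernoulli W).real (⋃ t ∈ (s i).T \ T' i, openConn (s 0).L.o t) ≤ η) →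
      1 - δs < (prodBernoulli W).real (s 0).L.reachB →
        1 - (δs + (n + 1 : ℕ) * (C * δ + η)) < (prodBernoulli W).real (⋃ t ∈ T' (Fin.last n), openConn (s 0).L.o t) := by
  obtain ⟨C, hC0, h⟩ := hA.chain_edge_additive
  refine ⟨C, hC0, fun n δ hδ hδ1 δs p hp1 G _ hΔ W s T' η ho hlink hsub hk hexc hsrc => ?_⟩
  have := h n hδ hδ1 p hp1 G hΔ W s T' η ho hlink hsub hk hexc
  linarith

end AdditiveTargetPropertyUP

end KNLevels

end Transplant

end Summit.CriticalPhenomena.PercolationContinuityZ3.Theorems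

end
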